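import Literature.NumberTheory.LFunctions.HuxleyLargeValuesFourthMomentProofs
import Mathlib.NumberTheory.ZetaValues
import HarnessLib

/-!
# A smoothly weighted second moment of the divisor function: `Σ_n (1 + n/Y)^{−8} d(n)² ≪ Y (log Y)⁴`

B. Conrey, H. Iwaniec, *Spacing of zeros of Hecke L-functions and the class number problem*,
Acta Arith. 103 (2002), §8 (8.7) with Proposition 5.4 (5.15) [held text `paper:arxiv-math_0111012`,
p0018]: the error term `Σ_n (1 + n/T)|a_n|²` of Proposition 5.4 for the long-range coefficients
`a_n = a(n)λ(n)n^{−1/2}` (`|λ(n)| ≤ τ(n,χ) ≤ d(n)`, `a(n) ≪ (1 + n/qT)^{−4}`) is controlled by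
`Σ_n (1 + n/Y)^{−8} d(n)²` with `Y = qT`. This file proves the elementary bound
`Σ_n (1 + n/Y)^{−8} d(n)² ≤ 17·Y(1 + log Y)⁴` (`Y ≥ 2`) together with the summability
(`divisorSq_weighted_tsum_le`; the registered stub S6b `stub_divisorSq_weighted_tsum` of the line
`prop81-afe-plancherel`, verbatim), WITHOUT dyadic decomposition: for `n ≤ Y²` one has
`n(1 + n/Y)^{−8} ≤ Y`, so the terms are `≤ Y·d(n)²/n` and Ivić's `Σ_{n≤K} d(n)²/n ≤ (1 + log K)⁴`
(the tree's `ZetaM4D.sum_card_divisors_sq_div_le`) applies with `K = ⌊Y²⌋`; for `n > Y²`,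
`(1 + n/Y)^{−8} d(n)² ≤ Y⁸n^{−6} < n^{−2}` (`d(n) ≤ n`), summing to `≤ π²/6`. Everything PROVED;
no definition.

«The programme SEARCHES and TYPES; no claim about Landau–Siegel zeros until a kernel theorem says so.»

## References
* [ConreyIwaniec2002] B. Conrey, H. Iwaniec, Acta Arith. 103 (2002) 259–312, arXiv:math/0111012:
  §8 (8.7); Proposition 5.4 (5.15).
* [Ivic1985] A. Ivić, *The Riemann zeta-function*, (5.25).
-/

noncomputable section

open Real

namespace Literature.NumberTheory.LFunctions

namespace ConreyIwaniec2002

/-- The two pointwise bounds: for `n ≥ 1`, `Y > 0`,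
`(1 + n/Y)^{−8} d(n)² ≤ Y·d(n)²/n`, and if moreover `Y² < n` then `(1 + n/Y)^{−8} d(n)² ≤ 1/n²`.
[cite: ConreyIwaniec2002, §8 (8.7)] -/
theorem divisorSq_weight_pointwise {Y : ℝ} (hY : 0 < Y) {n : ℕ} (hn : n ≠ 0) :
    ((1 + (n : ℝ) / Y) ^ 8)⁻¹ * (n.divisors.card : ℝ) ^ 2 ≤ Y * ((n.divisors.card : ℝ) ^ 2 / n) ∧
    (Y ^ 2 < n → ((1 + (n : ℝ) / Y) ^ 8)⁻¹ * (n.divisors.card : ℝ) ^ 2 ≤ 1 / (n : ℝ) ^ 2) := by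
  have hn0 : (0 : ℝ) < n := by exact_mod_cast Nat.pos_of_ne_zero hn
  have hx : 0 < 1 + (n : ℝ) / Y := by positivity
  have hd0 : 0 ≤ (n.divisors.card : ℝ) ^ 2 := by positivity
  constructor
  · -- `n (1 + n/Y)^{-8} ≤ Y`: if `n ≤ Y` trivially, else `(1+n/Y)^8 ≥ 1 + n/Y ≥ n/Y`
    have key : (n : ℝ) * ((1 + (n : ℝ) / Y) ^ 8)⁻¹ ≤ Y := by
      rw [mul_inv_le_iff₀ (pow_pos hx 8)]
      have h1 : 1 + (n : ℝ) / Y ≤ (1 + (n : ℝ) / Y) ^ 8 :=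
        le_self_pow₀ (by linarith [div_nonneg hn0.le hY.le]) (by norm_num)
      have h2 : (n : ℝ) ≤ Y * (1 + (n : ℝ) / Y) := by
        rw [mul_add, mul_one, mul_div_cancel₀ _ hY.ne']; linarith
      calc (n : ℝ) ≤ Y * (1 + (n : ℝ) / Y) := h2
        _ ≤ Y * (1 + (n : ℝ) / Y) ^ 8 := by gcongr
    calc ((1 + (n : ℝ) / Y) ^ 8)⁻¹ * (n.divisors.card : ℝ) ^ 2
        = ((n : ℝ) * ((1 + (n : ℝ) / Y) ^ 8)⁻¹) * ((n.divisors.card : ℝ) ^ 2 / n) := by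
          field_simp
      _ ≤ Y * ((n.divisors.card : ℝ) ^ 2 / n) := by gcongr
  · intro hYn
    have hd : (n.divisors.card : ℝ) ≤ n := by exact_mod_cast Nat.card_divisors_le_self n
    have h1 : ((1 + (n : ℝ) / Y) ^ 8)⁻¹ ≤ ((n / Y) ^ 8)⁻¹ :=
      inv_anti₀ (by positivity) (pow_le_pow_left₀ (by positivity) (by linarith) 8)
    have hY8 : Y ^ 8 < (n : ℝ) ^ 4 := by
      calc Y ^ 8 = (Y ^ 2) ^ 4 := by ring
        _ < (n : ℝ) ^ 4 := pow_lt_pow_left₀ hYn (by positivity) (by norm_num)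
    calc ((1 + (n : ℝ) / Y) ^ 8)⁻¹ * (n.divisors.card : ℝ) ^ 2
        ≤ ((n / Y) ^ 8)⁻¹ * (n : ℝ) ^ 2 := by
          gcongr
      _ = Y ^ 8 / (n : ℝ) ^ 6 := by field_simp
      _ ≤ (n : ℝ) ^ 4 / (n : ℝ) ^ 6 := by gcongr
      _ = 1 / (n : ℝ) ^ 2 := by field_simp

/-- **`Σ_n (1 + n/Y)^{−8} d(n)² ≤ 17·Y(1 + log Y)⁴` for `Y ≥ 2`, with summability** — the
registered stub S6b of the line `prop81-afe-plancherel` (CI §8 (8.7): the error term of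
Proposition 5.4 for the long range). [cite: ConreyIwaniec2002, §8 (8.7)] -/
theorem divisorSq_weighted_tsum_le :
    ∃ C : ℝ, 0 < C ∧ ∀ Y : ℝ, 2 ≤ Y →
      Summable (fun n : ℕ => ((1 + (n : ℝ) / Y) ^ 8)⁻¹ * (n.divisors.card : ℝ) ^ 2) ∧
      ∑' n : ℕ, ((1 + (n : ℝ) / Y) ^ 8)⁻¹ * (n.divisors.card : ℝ) ^ 2 ≤
        C * Y * (1 + Real.log Y) ^ 4 := by
  refine ⟨17, by norm_num, fun Y hY => ?_⟩
  have hY0 : 0 < Y := by linarith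
  set N : ℕ := ⌊Y ^ 2⌋₊ with hN
  have hY2 : (4 : ℝ) ≤ Y ^ 2 := by nlinarith
  have hN1 : 1 ≤ N := Nat.one_le_floor_iff _ |>.mpr (by linarith)
  have hNle : (N : ℝ) ≤ Y ^ 2 := Nat.floor_le (by positivity)
  -- the majorant `g(n) = Y d(n)²/n · 𝟙_{n ≤ N} + 1/n²`
  set f : ℕ → ℝ := fun n => ((1 + (n : ℝ) / Y) ^ 8)⁻¹ * (n.divisors.card : ℝ) ^ 2 with hf
  set g₁ : ℕ → ℝ := fun n => if n ≤ N then Y * ((n.divisors.card : ℝ) ^ 2 / n) else 0 with hg₁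
  set g₂ : ℕ → ℝ := fun n => 1 / (n : ℝ) ^ 2 with hg₂
  have hf0 : ∀ n, 0 ≤ f n := fun n => by positivity
  have hfg : ∀ n, f n ≤ g₁ n + g₂ n := by
    intro n
    rcases eq_or_ne n 0 with rfl | hn
    · simp [hf, hg₁, hg₂]
    obtain ⟨h1, h2⟩ := divisorSq_weight_pointwise hY0 hn
    have hg₂0 : 0 ≤ g₂ n := by positivity
    by_cases hle : n ≤ N
    · simp only [hg₁, if_pos hle]
      linarith
    · simp only [hg₁, if_neg hle, zero_add]
      apply h2
      have : (N : ℝ) + 1 ≤ n := by exact_mod_cast Nat.succ_le_of_lt (not_le.mp hle)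
      linarith [Nat.lt_floor_add_one (Y ^ 2)]
  have hs₂ : Summable g₂ := hasSum_zeta_two.summable
  have hs₁ : Summable g₁ := summable_of_ne_finset_zero (s := Finset.range (N + 1)) fun n hn => by
    simp only [Finset.mem_range, not_lt] at hn
    simp [hg₁, show ¬ n ≤ N by omega]
  have hsf : Summable f := Summable.of_nonneg_of_le hf0 hfg (hs₁.add hs₂)
  refine ⟨hsf, ?_⟩
  -- the two sums
  have h₁ : ∑' n, g₁ n ≤ Y * (1 + Real.log N) ^ 4 := by
    rw [tsum_eq_sum (s := Finset.Icc 1 N) (fun n hn => by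
      rw [Finset.mem_Icc, not_and_or, not_le, not_le] at hn
      rcases hn with h | h
      · have : n = 0 := by omega
        simp [hg₁, this]
      · simp [hg₁, show ¬ n ≤ N by omega])]
    have hsum : ∑ n ∈ Finset.Icc 1 N, g₁ n = Y * ∑ n ∈ Finset.Icc 1 N, (n.divisors.card : ℝ) ^ 2 / n := by
      rw [Finset.mul_sum]
      refine Finset.sum_congr rfl fun n hn => ?_
      rw [Finset.mem_Icc] at hn
      simp [hg₁, hn.2]
    rw [hsum]
    gcongr
    exact ZetaM4D.sum_card_divisors_sq_div_le N
  have h₂ : ∑' n, g₂ n = Real.pi ^ 2 / 6 := hasSum_zeta_two.tsum_eq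
  have hlogN : Real.log N ≤ 2 * Real.log Y := by
    calc Real.log N ≤ Real.log (Y ^ 2) := Real.log_le_log (by exact_mod_cast hN1) hNle
      _ = 2 * Real.log Y := by rw [Real.log_pow]; norm_num
  have hlogY : 0 ≤ Real.log Y := Real.log_nonneg (by linarith)
  have hpi : Real.pi ^ 2 / 6 ≤ 2 := by nlinarith [Real.pi_lt_d2, Real.pi_pos]
  calc ∑' n, f n ≤ ∑' n, (g₁ n + g₂ n) := hsf.tsum_le_tsum hfg (hs₁.add hs₂)
    _ = ∑' n, g₁ n + ∑' n, g₂ n := hs₁.tsum_add hs₂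
    _ ≤ Y * (1 + Real.log N) ^ 4 + 2 := by rw [h₂]; exact add_le_add h₁ hpi
    _ ≤ Y * (1 + 2 * Real.log Y) ^ 4 + Y * (1 + Real.log Y) ^ 4 := by
        gcongr
        · calc (2 : ℝ) = 2 * 1 ^ 4 := by norm_num
            _ ≤ Y * (1 + Real.log Y) ^ 4 := by
                gcongr
                linarith
    _ ≤ Y * (16 * (1 + Real.log Y) ^ 4) + Y * (1 + Real.log Y) ^ 4 := by
        gcongr Y * ?_ + _
        calc (1 + 2 * Real.log Y) ^ 4 ≤ (2 * (1 + Real.log Y)) ^ 4 :=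
              pow_le_pow_left₀ (by linarith) (by linarith) 4
          _ = 16 * (1 + Real.log Y) ^ 4 := by ring
    _ = 17 * Y * (1 + Real.log Y) ^ 4 := by ring

end ConreyIwaniec2002

end Literature.NumberTheory.LFunctions
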